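import Mathlib
import HarnessLib
import Summits.NavierStokesRegularity.NavierStokesRegularity.Theorems.TypeILiouvilleGeneralizedBeltrami

/-!
# TypeILiouvilleGeneralizedBeltramiFrame — crux (L) stmt-NavierStokesRegularity-10661 `TypeIliouvilleL`:
# GENERALIZED BELTRAMI IN A (NON-INERTIAL) TRANSLATING FRAME ⟹ ONE CONSTANT VECTOR

Helper for stmt-NavierStokesRegularity-10661 (`--supports`); theorems only, no definitions, no named-fact hypotheses;
closes no item; Navier–Stokes regularity is NOT proved here (leafhand seat of the EulerZoomLiouville route; sequel to
`TypeILiouvilleGeneralizedBeltrami`).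

Class P = print's class of bounded ancient mild solutions (KNSS 2009 §4 (i)).  Let `b : (−∞,0) → ℝ³` be ANY `C¹` drift
(not a symmetry of class P unless `b` is constant: accelerated Galilean frames destroy the bounded-pressure mild form).
If the Lamb vector of the RELATIVE velocity, `(v(t) − b(t)) × curl v(t)`, is curl-free on every slice — equivalently
`Dv(t)[ω] = Dω(t)[v(t) − b(t)]` — the class-P vorticity equation reads `∂ₜω = Δω − Dω[b(t)]`, a DRIFT–HEAT equation with
spatially constant drift; in the translating frame `y ↦ y + a(t)`, `a' = b`, the bounded smooth field `θ(t,y) = ω(t, y + a(t))`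
solves the heat equation on the open past slab, hence is one constant vector (`Literature.Analysis.PDE.heat_liouville`),
so every slice has constant curl and is constant by the endgame `eq_of_curl_eq_const_of_isDivFree_of_bounded`.

* ★ `classP_const_of_convect_comm_drift` (commutator–drift form), `classP_const_of_lambCurlFree_frame` (relative Lamb
  vector form), `classP_const_of_vorticity_parallel_frame` (`(v − b(t)) ∥ ω` pointwise: Beltrami in the moving frame).
The case `b ≡ 0` is `TypeILiouvilleGeneralizedBeltrami.classP_const_of_convect_comm`; the tangency-conditioned twin in the
unthreaded class is `PoloidalLiouville.Antidynamo.constant_of_lamb_curlFree` (route UnthreadedDoor), whose Galilean-frame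
bookkeeping (`curl_eq_zero_of_driftCaloric_unthreaded`) is adapted here.
HONEST LABEL: a classical sector; nothing here proves a registered stub, (L), or Navier–Stokes regularity; rung 0.
[cite: KochNadirashviliSereginSverak2009, §4 (i), Remark 6.1, proof of Thm 6.2 p. 13 (arXiv:0709.3599)]
[cite: MajdaBertozziCUP2002, §1.1 (vector identities), §2.3 (Beltrami flows)]
-/

noncomputable section
open MeasureTheory Filter Set Function Metric
open scoped Topology ENNReal RealInnerProductSpace Laplacian ContDiff
open Literature.Analysis Literature.Analysis.FluidPDE Literature.Analysis.UnboundedOperators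
set_option linter.dupNamespace false
namespace Summit.NavierStokesRegularity.NavierStokesRegularity.Theorems.TypeILiouvilleGeneralizedBeltrami

/-- ★ **COMMUTATOR–DRIFT FORM.**  A class-P flow with `Dv(t)(x)[curl v(t)(x)] = D(curl v(t))(x)[v(t)(x) − b(t)]` on
`(−∞,0) × ℝ³` for some `C¹` drift `b` on `(−∞,0)` is ONE CONSTANT VECTOR (drift–heat equation for the vorticity;
translating frame; heat Liouville; constant-curl endgame; KNSS Remark 6.1).
[cite: KochNadirashviliSereginSverak2009, §4 (i), Remark 6.1, proof of Thm 6.2 p. 13 (arXiv:0709.3599)] -/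
theorem classP_const_of_convect_comm_drift
    {v : ℝ → EuclideanSpace ℝ (Fin 3) → EuclideanSpace ℝ (Fin 3)}
    (hc : ContinuousOn (uncurry v) (Iio 0 ×ˢ univ))
    (hK : ∃ K : ℝ, ∀ t < 0, ∀ x, ‖v t x‖ ≤ K)
    (hd : ∀ t < 0, IsWeaklyDivFree (v t))
    (hm : ∀ s t : ℝ, s < t → t < 0 → ∀ x,
      v t x = heatExtension (v s) (t - s) x - oseenDuhamel 1 s v v t x)
    (b : ℝ → EuclideanSpace ℝ (Fin 3)) (hb : ContDiffOn ℝ 1 b (Iio 0))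
    (hcomm : ∀ t < 0, ∀ x, fderiv ℝ (v t) x (curl (v t) x) = fderiv ℝ (curl (v t)) x (v t x - b t)) :
    ∃ c : EuclideanSpace ℝ (Fin 3), ∀ t < 0, ∀ x, v t x = c := by
  obtain ⟨K, hKb⟩ := hK
  obtain ⟨hsm', hbounds⟩ := smooth_and_bounds_of_bounded_ancient_oseenMild hc hd hm hKb
  have hsm : IsSmoothSpaceTimeOn (Iio 0) v := hsm'
  have hvort : IsSmoothSpaceTimeOn (Iio 0) (vorticity v) := isSmoothSpaceTimeOn_vorticity_Iio hsm
  have hslice : ∀ t < 0, ContDiff ℝ 2 (v t) := fun t ht =>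
    (hsm.contDiff_slice (mem_Iio.2 ht)).of_le (by norm_cast)
  obtain ⟨C₁, hC₁⟩ := hbounds 1
  have hωbd : ∀ τ < 0, ∀ y, ‖curl (v τ) y‖ ≤ ‖curlCLM‖ * C₁ := by
    intro τ hτ y
    have h1 : ‖fderiv ℝ (v τ) y‖ ≤ C₁ := by
      have := hC₁ τ hτ y; rwa [norm_iteratedFDeriv_one] at this
    calc ‖curl (v τ) y‖ = ‖curlCLM (fderiv ℝ (v τ) y)‖ := rfl
      _ ≤ ‖curlCLM‖ * ‖fderiv ℝ (v τ) y‖ := ContinuousLinearMap.le_opNorm _ _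
      _ ≤ ‖curlCLM‖ * C₁ := mul_le_mul_of_nonneg_left h1 (norm_nonneg curlCLM)
  -- the drift–heat equation `∂ₜω = Δω − Dω[b t]`
  have hlaw : ∀ t < 0, ∀ x, deriv (fun s => curl (v s) x) t =
      (Δ (curl (v t))) x - fderiv ℝ (curl (v t)) x (b t) := by
    intro t ht x
    have h := TypeILiouvilleStrainLedger.classP_vorticity_eq hc ⟨K, hKb⟩ hd hm ht x
    rw [hcomm t ht x, map_sub] at h
    -- h : D + A = (A - B) + L
    have : deriv (fun s => curl (v s) x) t =
        fderiv ℝ (curl (v t)) x (v t x) - fderiv ℝ (curl (v t)) x (b t) + (Δ (curl (v t))) x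
          - fderiv ℝ (curl (v t)) x (v t x) := eq_sub_of_add_eq h
    rw [this]; abel
  -- the primitive `a` of `b` on `(−∞,0)`
  have hbc : ContinuousOn b (Iio 0) := hb.continuousOn
  set a : ℝ → EuclideanSpace ℝ (Fin 3) := fun t => ∫ s in (-1 : ℝ)..t, b s with ha_def
  have ha : ∀ t < 0, HasDerivAt a (b t) t := by
    intro t ht
    have hsub : uIcc (-1 : ℝ) t ⊆ Iio 0 := fun s hs => by
      have h2 := mem_uIcc.1 hs
      show s < 0
      rcases h2 with ⟨-, h⟩ | ⟨-, h⟩ <;> linarith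
    have hint : IntervalIntegrable b volume (-1) t := (hbc.mono hsub).intervalIntegrable
    exact intervalIntegral.integral_hasDerivAt_right hint (hbc.stronglyMeasurableAtFilter isOpen_Iio t ht)
      (hbc.continuousAt (Iio_mem_nhds ht))
  have hadiff : DifferentiableOn ℝ a (Iio 0) := fun t ht => (ha t ht).differentiableAt.differentiableWithinAt
  have ha2 : ContDiffOn ℝ 2 a (Iio 0) := by
    have e : (2 : WithTop ℕ∞) = 1 + 1 := by norm_num
    rw [e, contDiffOn_succ_iff_deriv_of_isOpen isOpen_Iio]
    exact ⟨hadiff, by simp, hb.congr fun t ht => (ha t ht).deriv⟩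
  have hO : IsOpen (Iio (0 : ℝ) ×ˢ (univ : Set (EuclideanSpace ℝ (Fin 3)))) := isOpen_Iio.prod isOpen_univ
  have hωinf : ContDiffOn ℝ ∞ (uncurry (vorticity v)) (Iio (0 : ℝ) ×ˢ univ) := hvort
  have hω2 : ContDiffOn ℝ 2 (uncurry (vorticity v)) (Iio (0 : ℝ) ×ˢ univ) := hωinf.of_le (by norm_cast)
  set Φ : ℝ × EuclideanSpace ℝ (Fin 3) → ℝ × EuclideanSpace ℝ (Fin 3) := fun p => (p.1, p.2 + a p.1) with hΦ
  have hΦs : ContDiffOn ℝ 2 Φ (Iio (0 : ℝ) ×ˢ univ) := by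
    have h1 : ContDiffOn ℝ 2 (fun p : ℝ × EuclideanSpace ℝ (Fin 3) => a p.1) (Iio (0 : ℝ) ×ˢ univ) :=
      ha2.comp contDiff_fst.contDiffOn fun p hp => hp.1
    exact contDiff_fst.contDiffOn.prodMk (contDiff_snd.contDiffOn.add h1)
  have hΦmaps : MapsTo Φ (Iio (0 : ℝ) ×ˢ univ) (Iio (0 : ℝ) ×ˢ univ) := fun p hp => ⟨hp.1, mem_univ _⟩
  set θ : ℝ → EuclideanSpace ℝ (Fin 3) → EuclideanSpace ℝ (Fin 3) := fun t y => curl (v t) (y + a t) with hθ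
  have hθeq : uncurry θ = uncurry (vorticity v) ∘ Φ := by
    funext p
    obtain ⟨t, y⟩ := p
    simp [hθ, hΦ, vorticity_apply]
  have hθ2 : ContDiffOn ℝ 2 (uncurry θ) (Iio (0 : ℝ) ×ˢ univ) := by
    rw [hθeq]
    exact hω2.comp hΦs hΦmaps
  -- the heat equation for `θ` in the Carleman frame
  have hheatθ : ∀ z ∈ Iio (0 : ℝ) ×ˢ (univ : Set (EuclideanSpace ℝ (Fin 3))),
      Carleman.dt (uncurry θ) z = Carleman.lap (uncurry θ) z := by
    rintro ⟨t, y⟩ hz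
    have ht : t < 0 := (mem_prod.1 hz).1
    set p : EuclideanSpace ℝ (Fin 3) := y + a t with hp
    have hzp : (t, p) ∈ Iio (0 : ℝ) ×ˢ (univ : Set (EuclideanSpace ℝ (Fin 3))) := ⟨ht, mem_univ _⟩
    have hdθ : DifferentiableAt ℝ (uncurry θ) (t, y) :=
      (hθ2.differentiableOn (by norm_num)).differentiableAt (hO.mem_nhds hz)
    have hdω : DifferentiableAt ℝ (uncurry (vorticity v)) (t, p) :=
      (hω2.differentiableOn (by norm_num)).differentiableAt (hO.mem_nhds hzp)
    have hγ : HasDerivAt (fun s : ℝ => (s, y + a s)) ((1 : ℝ), b t) t :=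
      (hasDerivAt_id t).prodMk ((ha t ht).const_add y)
    have hcomp : HasDerivAt (uncurry (vorticity v) ∘ fun s : ℝ => (s, y + a s))
        (fderiv ℝ (uncurry (vorticity v)) (t, p) ((1 : ℝ), b t)) t := by
      have hdω' : HasFDerivAt (uncurry (vorticity v)) (fderiv ℝ (uncurry (vorticity v)) (t, p))
          ((fun s : ℝ => (s, y + a s)) t) := by
        simpa only [hp] using hdω.hasFDerivAt
      exact hdω'.comp_hasDerivAt t hγ
    have hsplit : fderiv ℝ (uncurry (vorticity v)) (t, p) ((1 : ℝ), b t) =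
        timeDeriv (vorticity v) t p + fderiv ℝ (vorticity v t) p (b t) := by
      have e : ((1 : ℝ), b t) = ((1 : ℝ), (0 : EuclideanSpace ℝ (Fin 3))) + ((0 : ℝ), b t) := by simp
      rw [e, map_add, ← Carleman.dt_apply, ← Carleman.dx_apply, Carleman.dt_uncurry hdω, Carleman.dx_uncurry hdω]
    have hdt : Carleman.dt (uncurry θ) (t, y) = timeDeriv (vorticity v) t p + fderiv ℝ (vorticity v t) p (b t) := by
      rw [Carleman.dt_uncurry hdθ, Literature.Analysis.FluidPDE.timeDeriv_apply]
      have hfun : (fun s => θ s y) = uncurry (vorticity v) ∘ fun s : ℝ => (s, y + a s) := by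
        funext s; simp [hθ, vorticity_apply]
      rw [hfun, hcomp.deriv, hsplit]
    have hlaw' : timeDeriv (vorticity v) t p = (Δ (vorticity v t)) p - fderiv ℝ (vorticity v t) p (b t) := by
      rw [Literature.Analysis.FluidPDE.timeDeriv_apply]
      have hfun : (fun s => vorticity v s p) = fun s => curl (v s) p := by
        funext s; simp [vorticity_apply]
      rw [hfun, hlaw t ht p]
      simp [vorticity_apply]
    have hlap : Carleman.lap (uncurry θ) (t, y) = (Δ (vorticity v t)) p := by
      rw [Carleman.lap_uncurry hO hz hθ2]
      have hfun : θ t = fun z => vorticity v t (z + a t) := by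
        funext z; simp [hθ, vorticity_apply]
      rw [hfun, laplacian_comp_add_right]
    rw [hdt, hlaw', hlap]
    abel
  -- heat Liouville: `θ` is one constant vector
  have key : ∀ t t' : ℝ, t < 0 → t' < 0 → ∀ y y' : EuclideanSpace ℝ (Fin 3), θ t y = θ t' y' := by
    intro t t' ht ht' y y'
    have h := Literature.Analysis.PDE.heat_liouville (u := uncurry θ) (T := 0) (A := ‖curlCLM‖ * C₁) (γ := 0) le_rfl
      zero_lt_one hθ2 hheatθ ?_ (z := (t, y)) (w := (t', y')) (mem_prod.2 ⟨ht, mem_univ _⟩)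
      (mem_prod.2 ⟨ht', mem_univ _⟩)
    · simpa using h
    · rintro ⟨τ, z⟩ hz
      have hτ : τ < 0 := (mem_prod.1 hz).1
      rw [Real.rpow_zero, mul_one]
      exact hωbd τ hτ (z + a τ)
  have hconst : ∀ t < 0, ∀ x, curl (v t) x = curl (v t) 0 := by
    intro t ht x
    have h := key t t ht ht (x - a t) (0 - a t)
    simpa [hθ] using h
  -- constant curl on a slice ⟹ the slice is constant; the slice constants agree
  have hdiv' : ∀ t < 0, VectorCalculus.IsDivFree (v t) := fun t ht =>
    (hd t ht).isDivFree_of_contDiff ((hslice t ht).of_le (by norm_num))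
  have hub : ∀ t < 0, ∀ x, v t x = v t 0 := fun t ht x =>
    eq_of_curl_eq_const_of_isDivFree_of_bounded (hslice t ht) (c := curl (v t) 0)
      (fun z => hconst t ht z) (hdiv' t ht) (fun z => hKb t ht z) x 0
  have hmild1 : ∀ s t : ℝ, s < t → t < 0 → ∀ᵐ x ∂(volume : Measure (EuclideanSpace ℝ (Fin 3))),
      v t x = heatExtension (v s) (1 * (t - s)) x - oseenDuhamel 1 s v v t x :=
    fun s t hst ht => Eventually.of_forall fun x => by rw [one_mul]; exact hm s t hst ht x
  have htime := KNSS2009_remark61 one_pos (b := fun t => v t 0) hub hmild1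
  exact ⟨v (-1) 0, fun t ht x => by rw [hub t ht x]; exact htime t (-1) ht (by norm_num)⟩

/-- The relative Lamb vector identity: for a `C²` divergence-free `w` and a constant `β`,
`curl ((w − β) × curl w) = Dw[curl w] − D(curl w)[w − β]`. [cite: MajdaBertozziCUP2002, §1.1 (vector identities)] -/
theorem curl_lamb_sub_const_eq_sub {w : EuclideanSpace ℝ (Fin 3) → EuclideanSpace ℝ (Fin 3)} (hw : ContDiff ℝ 2 w)
    (hdiv : VectorCalculus.IsDivFree w) (β x : EuclideanSpace ℝ (Fin 3)) :
    curl (fun y => cross (w y - β) (curl w y)) x = fderiv ℝ w x (curl w x) - fderiv ℝ (curl w) x (w x - β) := by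
  have hω1 : ContDiff ℝ 1 (curl w) := contDiff_curl (n := 1) (by exact_mod_cast hw)
  have dω : DifferentiableAt ℝ (curl w) x := (hω1.differentiable one_ne_zero) x
  have dw : DifferentiableAt ℝ w x := (hw.differentiable two_ne_zero) x
  have dwβ : DifferentiableAt ℝ (fun y => w y - β) x := dw.sub_const β
  have hfd : fderiv ℝ (fun y => w y - β) x = fderiv ℝ w x := fderiv_sub_const β
  have hdivβ : VectorCalculus.divergence (fun y => w y - β) x = 0 := by
    rw [VectorCalculus.divergence, hfd]; exact hdiv x
  rw [curl_cross_apply (W := fun y => w y - β) dwβ dω, hdivβ, divergence_curl_eq_zero_holds w hw x, zero_smul,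
    zero_smul, sub_zero, add_zero, hfd]

/-- ★ **RELATIVE LAMB-VECTOR FORM — GENERALIZED BELTRAMI IN A TRANSLATING FRAME ⟹ ONE CONSTANT VECTOR.**  A class-P
flow for which `(v(t) − b(t)) × curl v(t)` is curl-free on every slice, for some `C¹` drift `b` on `(−∞,0)`, is one
constant vector. [cite: KochNadirashviliSereginSverak2009, §4 (i), Remark 6.1 (arXiv:0709.3599)] [cite: MajdaBertozziCUP2002, §2.3] -/
theorem classP_const_of_lambCurlFree_frame
    {v : ℝ → EuclideanSpace ℝ (Fin 3) → EuclideanSpace ℝ (Fin 3)}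
    (hc : ContinuousOn (uncurry v) (Iio 0 ×ˢ univ))
    (hK : ∃ K : ℝ, ∀ t < 0, ∀ x, ‖v t x‖ ≤ K)
    (hd : ∀ t < 0, IsWeaklyDivFree (v t))
    (hm : ∀ s t : ℝ, s < t → t < 0 → ∀ x,
      v t x = heatExtension (v s) (t - s) x - oseenDuhamel 1 s v v t x)
    (b : ℝ → EuclideanSpace ℝ (Fin 3)) (hb : ContDiffOn ℝ 1 b (Iio 0))
    (hlamb : ∀ t < 0, ∀ x, curl (fun y => cross (v t y - b t) (curl (v t) y)) x = 0) :
    ∃ c : EuclideanSpace ℝ (Fin 3), ∀ t < 0, ∀ x, v t x = c := by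
  obtain ⟨K, hKb⟩ := hK
  obtain ⟨hsm', -⟩ := smooth_and_bounds_of_bounded_ancient_oseenMild hc hd hm hKb
  have hsm : IsSmoothSpaceTimeOn (Iio 0) v := hsm'
  have hslice : ∀ t < 0, ContDiff ℝ 2 (v t) := fun t ht =>
    (hsm.contDiff_slice (mem_Iio.2 ht)).of_le (by norm_cast)
  have hdiv' : ∀ t < 0, VectorCalculus.IsDivFree (v t) := fun t ht =>
    (hd t ht).isDivFree_of_contDiff ((hslice t ht).of_le (by norm_num))
  refine classP_const_of_convect_comm_drift hc ⟨K, hKb⟩ hd hm b hb fun t ht x => ?_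
  have h := curl_lamb_sub_const_eq_sub (hslice t ht) (hdiv' t ht) (b t) x
  rw [hlamb t ht x] at h
  exact (sub_eq_zero.1 h.symm)

/-- **BELTRAMI IN A MOVING FRAME ⟹ ONE CONSTANT VECTOR**: if the relative velocity `v(t,x) − b(t)` is everywhere parallel
to the vorticity, `(v(t,x) − b(t)) × curl v(t)(x) = 0`, for a `C¹` drift `b`, the class-P flow is constant.
[cite: MajdaBertozziCUP2002, §2.3 (Beltrami flows)] [cite: KochNadirashviliSereginSverak2009, §4 (i) (arXiv:0709.3599)] -/
theorem classP_const_of_vorticity_parallel_frame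
    {v : ℝ → EuclideanSpace ℝ (Fin 3) → EuclideanSpace ℝ (Fin 3)}
    (hc : ContinuousOn (uncurry v) (Iio 0 ×ˢ univ))
    (hK : ∃ K : ℝ, ∀ t < 0, ∀ x, ‖v t x‖ ≤ K)
    (hd : ∀ t < 0, IsWeaklyDivFree (v t))
    (hm : ∀ s t : ℝ, s < t → t < 0 → ∀ x,
      v t x = heatExtension (v s) (t - s) x - oseenDuhamel 1 s v v t x)
    (b : ℝ → EuclideanSpace ℝ (Fin 3)) (hb : ContDiffOn ℝ 1 b (Iio 0))
    (hpar : ∀ t < 0, ∀ x, cross (v t x - b t) (curl (v t) x) = 0) :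
    ∃ c : EuclideanSpace ℝ (Fin 3), ∀ t < 0, ∀ x, v t x = c := by
  refine classP_const_of_lambCurlFree_frame hc hK hd hm b hb fun t ht x => ?_
  have hfun : (fun y => cross (v t y - b t) (curl (v t) y)) = fun _ => (0 : EuclideanSpace ℝ (Fin 3)) :=
    funext (hpar t ht)
  rw [hfun, curl_eq_curlCLM, fderiv_const_apply, map_zero]

end Summit.NavierStokesRegularity.NavierStokesRegularity.Theorems.TypeILiouvilleGeneralizedBeltrami

end
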